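import Literature.Computability.QuantumComplexity.GaussianPermanentMoments
import HarnessLib

/-!
# Second moments of Gaussian permanents with repeated columns

Companion to `GaussianPermanentMoments.lean` (`integral_norm_sq_permanent`: `𝔼 |Per X|² = n!` for
`X ∼ 𝒩(0,1)_ℂ^{n×n}`, Aaronson–Arkhipov, *The computational complexity of linear optics*, Theory
of Computing 9 (2013), §8 p. 219). For a column map `φ : Fin n → Fin n` let `X ∘ᶜ φ` denote the
matrix whose `j`-th column is column `φ j` of `X` (`(Matrix.of X).submatrix id φ`; columns of `X`
may repeat, others are dropped). This file proves the Wick count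

  `𝔼 |Per (X ∘ᶜ φ)|² = n! · ∏_c |φ⁻¹(c)|!`            (`integral_norm_sq_permanent_submatrix`)

— expand `|Per|² = ∑_{σ,τ} ∏ᵢ X_{i,φσi} conj X_{i,φτi}`; by independence of the rows and
`𝔼 X_{ia} conj X_{ib} = δ_{ab}` a pair `(σ, τ)` contributes `[φ ∘ σ = φ ∘ τ]`; for fixed `σ` the
number of such `τ` is the order of the stabiliser of `φ ∘ σ` in `S_n`, which is `∏_c |φ⁻¹(c)|!`
(Mathlib's `DomMulAct.stabilizer_card`). For `φ` a bijection this is `n!` again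
(`integral_norm_sq_permanent_submatrix_of_bijective`).

These second moments control the column-multilinear expansion of `Per (X (1 + M))` for a small
perturbation `M` (the terms of that expansion are exactly the `Per (X ∘ᶜ φ)`,
`Literature.LinearAlgebra.Matrix.permanent_mul_eq_sum` in
`LinearAlgebra/Matrix/PermanentColumnPerturbation.lean`), which is how the effect of
orthonormalising a Gaussian matrix with a planted block is bounded on the way to Aaronson–Arkhipov's
Thm. 1.3 (`BosonSamplingHardness.lean`, `gpeSolvableInFBPPRel_NP_of_uniformApproxBosonSampling`).
Relation to `PermanentColumnPerturbation.lean`: that file bounds the same second moment by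
`sⁿ · n! · n^{2·#moved φ}` for entries drawn independently from a *finite* seed law of second moment
`s` (`arrayExpect_norm_permanent_submatrix_sq_le`); here the law is the continuous Gaussian
ensemble `gaussianMatrixMeasure n` of the tree and the value is computed *exactly* (the stabiliser
count replaces the bound `#Stab ≤ n^{2·#moved}`).

## References

* S. Aaronson, A. Arkhipov, *The computational complexity of linear optics*, Theory of Computing 9
  (2013) 143–252, §8 p. 219 (the computation of `𝔼 |Per X|²`, which is the case `φ = id`).
* Mathlib, `Mathlib/GroupTheory/Perm/DomMulAct.lean` (`DomMulAct.stabilizer_card`: the number of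
  permutations `g` with `f ∘ g = f` is `∏ᵢ |f⁻¹(i)|!`).
-/

namespace Literature.Computability.QuantumComplexity

open _root_.MeasureTheory _root_.ProbabilityTheory
open scoped ENNReal NNReal ComplexConjugate

section ColumnMoments

variable (n : ℕ)

/-- Column substitution: `(Matrix.of X).submatrix id φ` is the matrix `(i, j) ↦ X i (φ j)` whose
`j`-th column is column `φ j` of `X`. [folklore] -/
theorem submatrix_of_id_eq (X : Fin n → Fin n → ℂ) (φ : Fin n → Fin n) :
    (Matrix.of X).submatrix id φ = Matrix.of (fun i j => X i (φ j)) := rfl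

/-- Each term `∏ᵢ X_{i,a(i)} conj(X_{i,b(i)})` (arbitrary column selections `a, b`, repetitions
allowed) is integrable against the Gaussian ensemble: rows are independent and entries have finite
second moments. [folklore] -/
theorem integrable_colSel_term (a b : Fin n → Fin n) :
    Integrable (fun X : Fin n → Fin n → ℂ => ∏ i, (X i (a i) * conj (X i (b i))))
      (gaussianMatrixMeasure n) := by
  rw [gaussianMatrixMeasure_eq_pi]
  refine Integrable.fintype_prod (f := fun i (r : Fin n → ℂ) => r (a i) * conj (r (b i)))
    (fun i => ?_)
  have h1 := memLp_eval_gaussianRowMeasure n (a i) 2 (by simp)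
  have h2 : MemLp (fun r : Fin n → ℂ => conj (r (b i))) 2 (gaussianRowMeasure n) :=
    (memLp_eval_gaussianRowMeasure n (b i) 2 (by simp)).of_le
      (Continuous.aestronglyMeasurable (by fun_prop)) (ae_of_all _ fun r => by simp)
  exact h1.integrable_mul h2

/-- **Wick pairing of one term**: `𝔼 ∏ᵢ X_{i,a(i)} conj(X_{i,b(i)}) = [a = b]` for arbitrary column
selections `a, b : Fin n → Fin n` — the rows are independent and `𝔼 X_{ia} conj X_{ib} = δ_{ab}`
(`integral_eval_mul_conj_eval`). The case of permutations is `integral_perm_term`. [folklore] -/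
theorem integral_colSel_term (a b : Fin n → Fin n) :
    ∫ X, ∏ i, (X i (a i) * conj (X i (b i))) ∂gaussianMatrixMeasure n =
      if a = b then 1 else 0 := by
  rw [gaussianMatrixMeasure_eq_pi,
    integral_fintype_prod_eq_prod (f := fun i (r : Fin n → ℂ) => r (a i) * conj (r (b i)))]
  simp_rw [integral_eval_mul_conj_eval]
  rw [Finset.prod_boole]
  by_cases h : a = b
  · subst h; simp
  · have h' : ¬ ∀ i ∈ (Finset.univ : Finset (Fin n)), a i = b i :=
      fun hall => h (funext fun i => hall i (Finset.mem_univ i))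
    rw [if_neg h', if_neg h]

/-- The number of permutations `τ` with `φ ∘ τ = φ ∘ σ` is the order `∏_c |φ⁻¹(c)|!` of the
stabiliser of `φ` in `S_n` (translate by `σ`: `τ = σρ` with `(φ ∘ σ) ∘ ρ = φ ∘ σ`, then
`DomMulAct.stabilizer_card` and `|(φσ)⁻¹(c)| = |φ⁻¹(c)|`). [folklore] -/
theorem card_perm_comp_eq_comp (φ : Fin n → Fin n) (σ : Equiv.Perm (Fin n)) :
    Fintype.card {τ : Equiv.Perm (Fin n) // φ ∘ ⇑τ = φ ∘ ⇑σ} =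
      ∏ c : Fin n, (Fintype.card {j : Fin n // φ j = c}).factorial := by
  classical
  -- translate by `σ`
  have h1 : Fintype.card {τ : Equiv.Perm (Fin n) // φ ∘ ⇑τ = φ ∘ ⇑σ} =
      Fintype.card {ρ : Equiv.Perm (Fin n) // (φ ∘ ⇑σ) ∘ ⇑ρ = φ ∘ ⇑σ} := by
    refine Fintype.card_congr ((Equiv.subtypeEquiv (Equiv.mulLeft σ) fun ρ => ?_).symm)
    simp only [Equiv.coe_mulLeft, Equiv.Perm.coe_mul, Function.comp_assoc]
  rw [h1, DomMulAct.stabilizer_card (φ ∘ ⇑σ)]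
  refine Finset.prod_congr rfl fun c _ => ?_
  congr 1
  exact Fintype.card_congr (Equiv.subtypeEquiv σ fun j => Iff.rfl)

/-- **Second moment of a Gaussian permanent with repeated columns.** For `X ∼ 𝒩(0,1)_ℂ^{n×n}` and
any column map `φ : Fin n → Fin n`,
`𝔼 |Per ((Matrix.of X).submatrix id φ)|² = n! · ∏_c |φ⁻¹(c)|!`.
Proof: `|Per|² = ∑_{σ,τ} ∏ᵢ X_{i,φσi} conj X_{i,φτi}` (`norm_sq_permanent_eq_sum`), each pair
contributes `[φ ∘ σ = φ ∘ τ]` (`integral_colSel_term`), and for fixed `σ` there are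
`∏_c |φ⁻¹(c)|!` admissible `τ` (`card_perm_comp_eq_comp`). The case `φ = id` is Aaronson–Arkhipov's
`𝔼 |Per X|² = n!` (§8, p. 219; `integral_norm_sq_permanent`). [folklore] -/
theorem integral_norm_sq_permanent_submatrix (φ : Fin n → Fin n) :
    ∫ X, ‖((Matrix.of X).submatrix id φ).permanent‖ ^ 2 ∂gaussianMatrixMeasure n =
      (n.factorial : ℝ) * ∏ c : Fin n, ((Fintype.card {j : Fin n // φ j = c}).factorial : ℝ) := by
  classical
  apply Complex.ofReal_injective
  rw [← integral_complex_ofReal]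
  have hexp : ∀ X : Fin n → Fin n → ℂ,
      (((‖((Matrix.of X).submatrix id φ).permanent‖ ^ 2 : ℝ)) : ℂ) =
        ∑ σ : Equiv.Perm (Fin n), ∑ τ : Equiv.Perm (Fin n),
          ∏ i, (X i ((φ ∘ ⇑σ) i) * conj (X i ((φ ∘ ⇑τ) i))) := fun X => by
    rw [submatrix_of_id_eq, norm_sq_permanent_eq_sum]
    rfl
  simp_rw [hexp]
  rw [integral_finsetSum _ (fun (σ : Equiv.Perm (Fin n)) _ => integrable_finsetSum _
    (fun (τ : Equiv.Perm (Fin n)) _ => integrable_colSel_term n (φ ∘ ⇑σ) (φ ∘ ⇑τ)))]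
  have hinner : ∀ σ : Equiv.Perm (Fin n),
      ∫ X : Fin n → Fin n → ℂ, ∑ τ : Equiv.Perm (Fin n),
          ∏ i, (X i ((φ ∘ ⇑σ) i) * conj (X i ((φ ∘ ⇑τ) i))) ∂gaussianMatrixMeasure n =
        ∑ τ : Equiv.Perm (Fin n), (if φ ∘ ⇑σ = φ ∘ ⇑τ then (1 : ℂ) else 0) := fun σ => by
    rw [integral_finsetSum _
      (fun (τ : Equiv.Perm (Fin n)) _ => integrable_colSel_term n (φ ∘ ⇑σ) (φ ∘ ⇑τ))]
    simp_rw [integral_colSel_term]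
  simp_rw [hinner]
  -- count: for each `σ`, the inner sum is the number of `τ` with `φ ∘ σ = φ ∘ τ`
  have hcount : ∀ σ : Equiv.Perm (Fin n),
      (∑ τ : Equiv.Perm (Fin n), (if φ ∘ ⇑σ = φ ∘ ⇑τ then (1 : ℂ) else 0)) =
        ((∏ c : Fin n, (Fintype.card {j : Fin n // φ j = c}).factorial : ℕ) : ℂ) := fun σ => by
    rw [Finset.sum_boole, ← card_perm_comp_eq_comp n φ σ, Fintype.card_subtype]
    congr 2
    ext τ
    simp only [Finset.mem_filter, Finset.mem_univ, true_and]
    exact eq_comm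
  simp_rw [hcount]
  rw [Finset.sum_const, Finset.card_univ, Fintype.card_perm, Fintype.card_fin, nsmul_eq_mul]
  push_cast
  ring

/-- For a bijective column map (a column permutation) the second moment is again `n!`:
`𝔼 |Per (X ∘ᶜ φ)|² = n!` (every fibre is a singleton). [folklore] -/
theorem integral_norm_sq_permanent_submatrix_of_bijective {φ : Fin n → Fin n}
    (hφ : Function.Bijective φ) :
    ∫ X, ‖((Matrix.of X).submatrix id φ).permanent‖ ^ 2 ∂gaussianMatrixMeasure n =
      (n.factorial : ℝ) := by
  rw [integral_norm_sq_permanent_submatrix]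
  have h1 : ∀ c : Fin n, Fintype.card {j : Fin n // φ j = c} = 1 := fun c => by
    rw [Fintype.card_eq_one_iff]
    obtain ⟨j, hj⟩ := hφ.2 c
    exact ⟨⟨j, hj⟩, fun ⟨j', hj'⟩ => Subtype.ext (hφ.1 (hj'.trans hj.symm))⟩
  simp [h1]

/-- `|Per (X ∘ᶜ φ)|²` is integrable against the Gaussian ensemble (a finite sum of integrable Wick
terms). [folklore] -/
theorem integrable_norm_sq_permanent_submatrix (φ : Fin n → Fin n) :
    Integrable (fun X : Fin n → Fin n → ℂ => ‖((Matrix.of X).submatrix id φ).permanent‖ ^ 2)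
      (gaussianMatrixMeasure n) := by
  have h : Integrable (fun X : Fin n → Fin n → ℂ =>
      ((‖((Matrix.of X).submatrix id φ).permanent‖ ^ 2 : ℝ) : ℂ)) (gaussianMatrixMeasure n) := by
    have hexp : ∀ X : Fin n → Fin n → ℂ,
        (((‖((Matrix.of X).submatrix id φ).permanent‖ ^ 2 : ℝ)) : ℂ) =
          ∑ σ : Equiv.Perm (Fin n), ∑ τ : Equiv.Perm (Fin n),
            ∏ i, (X i ((φ ∘ ⇑σ) i) * conj (X i ((φ ∘ ⇑τ) i))) := fun X => by
      rw [submatrix_of_id_eq, norm_sq_permanent_eq_sum]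
      rfl
    simp_rw [hexp]
    exact integrable_finsetSum _ fun σ _ =>
      integrable_finsetSum _ fun τ _ => integrable_colSel_term n (φ ∘ ⇑σ) (φ ∘ ⇑τ)
  have h' := h.re
  simp only [RCLike.re_to_complex, Complex.ofReal_re] at h'
  exact h'

/-- The second moment as a squared `L²` norm: `Per (X ∘ᶜ φ) ∈ L²(𝒩(0,1)_ℂ^{n×n})` (continuous,
with integrable square). [folklore] -/
theorem memLp_two_permanent_submatrix (φ : Fin n → Fin n) :
    MemLp (fun X : Fin n → Fin n → ℂ => ((Matrix.of X).submatrix id φ).permanent) 2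
      (gaussianMatrixMeasure n) := by
  have hcont : Continuous fun X : Fin n → Fin n → ℂ => ((Matrix.of X).submatrix id φ).permanent := by
    simp_rw [submatrix_of_id_eq]
    exact (continuous_permanent_of n).comp (by fun_prop)
  refine (memLp_two_iff_integrable_sq_norm hcont.aestronglyMeasurable).2 ?_
  exact integrable_norm_sq_permanent_submatrix n φ

end ColumnMoments

end Literature.Computability.QuantumComplexity
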